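import Summits.QuantumFields.YangMills.Theorems.LuscherReductionOneSiteLevelsGnKinetic
import Summits.QuantumFields.YangMills.Theorems.LuscherReductionOneSiteLevelsGnHaar
import Literature.Analysis.OperatorTheory.YangMillsMatrixModelValleyBound

/-!
# VALLEY, step 1: the exact `c + ℓ + q` structure of the one-site action under a kinetic step, and the GLOBAL exponent bound
# (support module for `stub_absUpperValleyMag` of crux `OneSiteLevels`, route `LuscherReduction`, item stmt-QuantumFields-20007;
# fleet lead prover ym-luscher-20007-p1 g2)

Quaternion coordinates `U_e ↔ (u_{e,0}, u⃗_e)` make the one-site model polynomial: `S(U) = 2 Σ_{i,j} |u⃗_i × u⃗_j|²` (tree: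
`wilsonAction_one_site_eq_luscherPotential`), `Re tr(U V⁻¹) = 2⟨u, v⟩`.  For a kinetic step `V = U·W` (`W_e` near `1`):
`v⃗_e = u⃗_e + α_e` with `|α_e|² ≤ 2 − 2 w_{e,0} = 2 − Re tr W_e` (`dot_self_vecPart_mul_sub_le`), the time-like coupling is EXACTLY
`Σ_e Re tr(U_e V_e⁻¹) = 6 − D(W)`, `D(W) = Σ_e (2 − 2 w_{e,0})` (`timeCoupling_mul_eq`), and `v⃗_i × v⃗_j = c_{ij} + r_{ij}` with `c_{ij} = u⃗_i × u⃗_j`,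
`|r_{ij}| ≤ |u⃗_i||α_j| + |α_i||u⃗_j| + |α_i||α_j|`.  Cauchy–Schwarz over the pairs gives the global action deficit bound
(`wilsonAction_mul_ge`)

  `S(U·W) ≥ S(U) − 4√2 ρ(U) √S(U) √D(W) − 2√2 √S(U) D(W)`,   `ρ(U)² = ‖zmCoord 1 U‖² = Σ_e |u⃗_e|²`,

and hence, for every `τ ≥ −½`, the GLOBAL bound on the exponent of the weighted supersolution test of the VALLEY line (weight
`h = e^{−τBS}`): (`valley_exponent_le`)

  `(τ−½) S(U) + Σ_e Re tr(U_e(U·W)_e⁻¹) − (½+τ) S(U·W) ≤ 6 − ½ S(U) − D(W)·(1 − 16(½+τ)² ρ(U)² − 2√2 (½+τ) √S(U))`.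

## WHAT THIS IS NOT
Pure algebra; NOT the valley estimate, NOT the crux, NOT THE CLAY GAP.  Sorry-free; no new definition, no named fact.
-/

set_option autoImplicit false

noncomputable section

open MeasureTheory Filter Topology Real
open scoped Matrix Quaternion RealInnerProductSpace
open Literature.MathematicalPhysics.QuantumFieldTheory
open Literature.MathematicalPhysics.QuantumLattice
open Literature.Analysis.OperatorTheory.YMMatrixModel

namespace Summit.QuantumFields.YangMills.Theorems.FemtoTransferGap

/-! ### §1. Euclidean geometry of `ℝ³` in `dotProduct`/`crossProduct` form (Lagrange, Cauchy–Schwarz, triangle) -/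

/-- `|x·y| ≤ |x||y|` (Cauchy–Schwarz from Lagrange's identity `|x × y|² = |x|²|y|² − (x·y)² ≥ 0`). [folklore] -/
theorem abs_dot_le_sqrt_mul_sqrt (x y : Fin 3 → ℝ) : |x ⬝ᵥ y| ≤ √(x ⬝ᵥ x) * √(y ⬝ᵥ y) := by
  have hx : 0 ≤ x ⬝ᵥ x := Finset.sum_nonneg fun _ _ => mul_self_nonneg _
  have h : 0 ≤ (x ⨯₃ y) ⬝ᵥ (x ⨯₃ y) := Finset.sum_nonneg fun _ _ => mul_self_nonneg _
  rw [cross_dot_cross, dotProduct_comm y x] at h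
  rw [← Real.sqrt_mul hx, ← Real.sqrt_sq_eq_abs]
  exact Real.sqrt_le_sqrt (by nlinarith [h])

/-- `|x × y| ≤ |x||y|`. [folklore] -/
theorem sqrt_cross_dot_self_le (x y : Fin 3 → ℝ) : √((x ⨯₃ y) ⬝ᵥ (x ⨯₃ y)) ≤ √(x ⬝ᵥ x) * √(y ⬝ᵥ y) := by
  have hx : 0 ≤ x ⬝ᵥ x := Finset.sum_nonneg fun _ _ => mul_self_nonneg _
  rw [← Real.sqrt_mul hx]
  refine Real.sqrt_le_sqrt ?_
  rw [cross_dot_cross, dotProduct_comm y x]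
  nlinarith [sq_nonneg (x ⬝ᵥ y)]

/-- Triangle inequality `|x + y| ≤ |x| + |y|`. [folklore] -/
theorem sqrt_dot_self_add_le (x y : Fin 3 → ℝ) : √((x + y) ⬝ᵥ (x + y)) ≤ √(x ⬝ᵥ x) + √(y ⬝ᵥ y) := by
  have hx : 0 ≤ x ⬝ᵥ x := Finset.sum_nonneg fun _ _ => mul_self_nonneg _
  have hy : 0 ≤ y ⬝ᵥ y := Finset.sum_nonneg fun _ _ => mul_self_nonneg _
  rw [Real.sqrt_le_left (by positivity)]
  have h1 := abs_dot_le_sqrt_mul_sqrt x y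
  have h2 := le_abs_self (x ⬝ᵥ y)
  have e : (x + y) ⬝ᵥ (x + y) = x ⬝ᵥ x + 2 * (x ⬝ᵥ y) + y ⬝ᵥ y := by
    rw [add_dotProduct, dotProduct_add, dotProduct_add, dotProduct_comm y x]; ring
  rw [e, add_sq, Real.sq_sqrt hx, Real.sq_sqrt hy]
  nlinarith

/-- `|x − x'| … ` form used below: `|c + r|² ≥ |c|² − 2|c||r|`. [folklore] -/
theorem dot_self_add_ge (c r : Fin 3 → ℝ) :
    c ⬝ᵥ c - 2 * (√(c ⬝ᵥ c) * √(r ⬝ᵥ r)) ≤ (c + r) ⬝ᵥ (c + r) := by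
  have hr : 0 ≤ r ⬝ᵥ r := Finset.sum_nonneg fun _ _ => mul_self_nonneg _
  have h1 := abs_dot_le_sqrt_mul_sqrt c r
  have h2 := neg_abs_le (c ⬝ᵥ r)
  have e : (c + r) ⬝ᵥ (c + r) = c ⬝ᵥ c + 2 * (c ⬝ᵥ r) + r ⬝ᵥ r := by
    rw [add_dotProduct, dotProduct_add, dotProduct_add, dotProduct_comm r c]; ring
  rw [e]
  linarith

/-! ### §2. Quaternion link algebra: products, the displacement `α = v⃗ − u⃗` of a kinetic step, and the time-like coupling -/

/-- `(UW)₀ = u₀w₀ − u⃗·w⃗`. [cite: BrockerTomDieck1985, I (1.10)] -/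
theorem scalarPart_mul (U W : SU2) : scalarPart (U * W) = scalarPart U * scalarPart W - vecPart U ⬝ᵥ vecPart W := by
  simp only [scalarPart, vecPart, su2Quat_mul, Quaternion.re_mul, dotProduct, Fin.sum_univ_three, Matrix.cons_val_zero,
    Matrix.cons_val_one, Matrix.head_cons, Matrix.cons_val_two, Matrix.tail_cons]
  ring

/-- `(UW)⃗ = u₀ w⃗ + w₀ u⃗ + u⃗ × w⃗`. [cite: BrockerTomDieck1985, I (1.10)] -/
theorem vecPart_mul (U W : SU2) :
    vecPart (U * W) = scalarPart U • vecPart W + scalarPart W • vecPart U + vecPart U ⨯₃ vecPart W := by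
  funext a
  simp only [scalarPart, vecPart, su2Quat_mul, Pi.add_apply, Pi.smul_apply, smul_eq_mul, cross_apply]
  fin_cases a <;>
    simp [Quaternion.imI_mul, Quaternion.imJ_mul, Quaternion.imK_mul, Matrix.cons_val_zero, Matrix.cons_val_one,
      Matrix.head_cons, Matrix.cons_val_two, Matrix.tail_cons] <;> ring

/-- **The displacement of the vector part under a kinetic step is at most the step**: `|(UW)⃗ − u⃗|² ≤ 2 − 2w₀ = 2 − Re tr W`
(`= |q_U (q_W − 1)|² − (real part)²`, `|q_U| = 1`). [folklore] -/
theorem dot_self_vecPart_mul_sub_le (U W : SU2) :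
    (vecPart (U * W) - vecPart U) ⬝ᵥ (vecPart (U * W) - vecPart U) ≤ 2 - 2 * scalarPart W := by
  -- the quaternion `q = q_U (q_W − 1)`
  set q : ℍ := su2Quat U * (su2Quat W - 1) with hq
  have hdiff : su2Quat (U * W) - su2Quat U = q := by rw [hq, mul_sub, mul_one, su2Quat_mul]
  have hcomp : ∀ a, (vecPart (U * W) - vecPart U) a = ![q.imI, q.imJ, q.imK] a := by
    intro a
    rw [← hdiff]
    fin_cases a <;> simp [vecPart]
  have hv : vecPart (U * W) - vecPart U = ![q.imI, q.imJ, q.imK] := funext hcomp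
  have hnq : Quaternion.normSq q = 2 - 2 * scalarPart W := by
    rw [hq, map_mul, normSq_su2Quat, one_mul, Quaternion.normSq_def']
    have h1 := normSq_su2Quat W
    rw [Quaternion.normSq_def'] at h1
    simp only [scalarPart]
    show (su2Quat W - 1).re ^ 2 + (su2Quat W - 1).imI ^ 2 + (su2Quat W - 1).imJ ^ 2 + (su2Quat W - 1).imK ^ 2 = _
    simp only [Quaternion.re_sub, Quaternion.imI_sub, Quaternion.imJ_sub, Quaternion.imK_sub, Quaternion.re_one,
      Quaternion.imI_one, Quaternion.imJ_one, Quaternion.imK_one, sub_zero]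
    have h1' : (su2Quat W).re ^ 2 + (su2Quat W).imI ^ 2 + (su2Quat W).imJ ^ 2 + (su2Quat W).imK ^ 2 = 1 := h1
    nlinarith [h1']
  rw [hv]
  simp only [dotProduct, Fin.sum_univ_three, Matrix.cons_val_zero, Matrix.cons_val_one, Matrix.head_cons, Matrix.cons_val_two,
    Matrix.tail_cons]
  have hn : Quaternion.normSq q = q.re ^ 2 + q.imI ^ 2 + q.imJ ^ 2 + q.imK ^ 2 := Quaternion.normSq_def' q
  nlinarith [sq_nonneg q.re]

/-- `0 ≤ 2 − 2w₀`. [folklore] -/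
theorem two_sub_two_mul_scalarPart_nonneg (W : SU2) : 0 ≤ 2 - 2 * scalarPart W := by
  have h := abs_scalarPart_le W
  rw [abs_le] at h
  linarith

/-- `2 − 2w₀ ≤ 4`. [folklore] -/
theorem two_sub_two_mul_scalarPart_le_four (W : SU2) : 2 - 2 * scalarPart W ≤ 4 := by
  have h := abs_scalarPart_le W
  rw [abs_le] at h
  linarith

/-- **The time-like coupling of a kinetic step is EXACTLY `6 − D(W)`**: `Σ_e Re tr(U_e (U_eW_e)⁻¹) = Σ_e 2 w_{e,0}`.
[cite: Luscher1983, §2] -/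
theorem timeCoupling_mul_eq (U W : Cfg) :
    timeCoupling su2Rep U (U * W) = 6 - ∑ e : Edge 3 1, (2 - 2 * scalarPart (W e)) := by
  unfold timeCoupling
  have hcard : (Finset.univ : Finset (Edge 3 1)).card = 3 := by simp
  have h6 : (6 : ℝ) = ∑ _e : Edge 3 1, (2 : ℝ) := by rw [Finset.sum_const, hcard]; norm_num
  rw [h6, ← Finset.sum_sub_distrib]
  refine Finset.sum_congr rfl fun e _ => ?_
  rw [Pi.mul_apply, fundamentalRep_apply, show U e * (U e * W e)⁻¹ = U e * (W e)⁻¹ * (U e)⁻¹ by group,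
    re_trace_eq_two_mul_scalarPart, scalarPart_conj, ← re_trace_eq_two_mul_scalarPart, re_trace_inv,
    re_trace_eq_two_mul_scalarPart]
  ring

/-- Discrete Cauchy–Schwarz in square-root form: `Σ f g ≤ √(Σ f²) √(Σ g²)`. [folklore] -/
theorem sum_mul_le_sqrt_mul_sqrt {ι : Type*} (s : Finset ι) (f g : ι → ℝ) :
    ∑ i ∈ s, f i * g i ≤ √(∑ i ∈ s, f i ^ 2) * √(∑ i ∈ s, g i ^ 2) := by
  rw [← Real.sqrt_mul (Finset.sum_nonneg fun _ _ => sq_nonneg _)]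
  exact (le_abs_self _).trans (Real.abs_le_sqrt (Finset.sum_mul_sq_le_sq_mul_sq s f g))

/-- Cauchy–Schwarz over the ordered pairs with a product weight: `Σ_p n_p f_{p.1} g_{p.2} ≤ √(Σ n²)·√(Σ f²)·√(Σ g²)`. [folklore] -/
theorem sum_pairs_mul_le (n : Fin 3 × Fin 3 → ℝ) (f g : Fin 3 → ℝ) :
    ∑ p : Fin 3 × Fin 3, n p * (f p.1 * g p.2) ≤ √(∑ p : Fin 3 × Fin 3, n p ^ 2) * (√(∑ i, f i ^ 2) * √(∑ i, g i ^ 2)) := by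
  have h := sum_mul_le_sqrt_mul_sqrt Finset.univ n (fun p : Fin 3 × Fin 3 => f p.1 * g p.2)
  refine h.trans (mul_le_mul_of_nonneg_left (le_of_eq ?_) (Real.sqrt_nonneg _))
  rw [← Real.sqrt_mul (Finset.sum_nonneg fun _ _ => sq_nonneg _), Fintype.sum_mul_sum, ← Fintype.sum_prod_type']
  congr 1
  refine Finset.sum_congr rfl fun p _ => ?_
  ring

/-! ### §3. One pair under a kinetic step: `|(x₁+α₁) × (x₂+α₂)|² ≥ |x₁ × x₂|² − 2|x₁ × x₂|(|x₁||α₂| + |α₁||x₂| + |α₁||α₂|)` -/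

/-- The pair inequality: with `c = x₁ × x₂` and `r = (x₁+α₁) × (x₂+α₂) − c = x₁ × α₂ + α₁ × x₂ + α₁ × α₂`,
`|c + r|² ≥ |c|² − 2|c||r|` and `|r| ≤ |x₁||α₂| + |α₁||x₂| + |α₁||α₂|`. [folklore] -/
theorem pair_step_ge (x₁ x₂ a₁ a₂ : Fin 3 → ℝ) :
    (x₁ ⨯₃ x₂) ⬝ᵥ (x₁ ⨯₃ x₂) - 2 * (√((x₁ ⨯₃ x₂) ⬝ᵥ (x₁ ⨯₃ x₂)) *
        (√(x₁ ⬝ᵥ x₁) * √(a₂ ⬝ᵥ a₂) + √(a₁ ⬝ᵥ a₁) * √(x₂ ⬝ᵥ x₂) + √(a₁ ⬝ᵥ a₁) * √(a₂ ⬝ᵥ a₂)))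
      ≤ ((x₁ + a₁) ⨯₃ (x₂ + a₂)) ⬝ᵥ ((x₁ + a₁) ⨯₃ (x₂ + a₂)) := by
  have e : (x₁ + a₁) ⨯₃ (x₂ + a₂) = x₁ ⨯₃ x₂ + (x₁ ⨯₃ a₂ + a₁ ⨯₃ x₂ + a₁ ⨯₃ a₂) := by
    simp only [map_add, LinearMap.add_apply]
    abel
  rw [e]
  have hp := dot_self_add_ge (x₁ ⨯₃ x₂) (x₁ ⨯₃ a₂ + a₁ ⨯₃ x₂ + a₁ ⨯₃ a₂)
  have hr : √((x₁ ⨯₃ a₂ + a₁ ⨯₃ x₂ + a₁ ⨯₃ a₂) ⬝ᵥ (x₁ ⨯₃ a₂ + a₁ ⨯₃ x₂ + a₁ ⨯₃ a₂))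
      ≤ √(x₁ ⬝ᵥ x₁) * √(a₂ ⬝ᵥ a₂) + √(a₁ ⬝ᵥ a₁) * √(x₂ ⬝ᵥ x₂) + √(a₁ ⬝ᵥ a₁) * √(a₂ ⬝ᵥ a₂) :=
    calc √((x₁ ⨯₃ a₂ + a₁ ⨯₃ x₂ + a₁ ⨯₃ a₂) ⬝ᵥ (x₁ ⨯₃ a₂ + a₁ ⨯₃ x₂ + a₁ ⨯₃ a₂))
        ≤ √((x₁ ⨯₃ a₂ + a₁ ⨯₃ x₂) ⬝ᵥ (x₁ ⨯₃ a₂ + a₁ ⨯₃ x₂)) + √((a₁ ⨯₃ a₂) ⬝ᵥ (a₁ ⨯₃ a₂)) :=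
          sqrt_dot_self_add_le _ _
      _ ≤ (√((x₁ ⨯₃ a₂) ⬝ᵥ (x₁ ⨯₃ a₂)) + √((a₁ ⨯₃ x₂) ⬝ᵥ (a₁ ⨯₃ x₂))) + √(a₁ ⬝ᵥ a₁) * √(a₂ ⬝ᵥ a₂) :=
          add_le_add (sqrt_dot_self_add_le _ _) (sqrt_cross_dot_self_le _ _)
      _ ≤ (√(x₁ ⬝ᵥ x₁) * √(a₂ ⬝ᵥ a₂) + √(a₁ ⬝ᵥ a₁) * √(x₂ ⬝ᵥ x₂)) + √(a₁ ⬝ᵥ a₁) * √(a₂ ⬝ᵥ a₂) :=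
          add_le_add (add_le_add (sqrt_cross_dot_self_le _ _) (sqrt_cross_dot_self_le _ _)) le_rfl
  have hc0 : 0 ≤ √((x₁ ⨯₃ x₂) ⬝ᵥ (x₁ ⨯₃ x₂)) := Real.sqrt_nonneg _
  have hq := mul_le_mul_of_nonneg_left hr hc0
  linarith

/-! ### §4. Families: the action of `SU(2)³` after a kinetic step -/

/-- `S(U) = 2 Σ_{(i,j)} |u⃗_i × u⃗_j|²`, `u⃗_i = colourVec (zmCoord 1 U) i`. [cite: Luscher1983, §2] -/
theorem wilsonAction_eq_two_mul_sum_cross (U : Cfg) :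
    wilsonAction su2Rep U = 2 * ∑ p : Fin 3 × Fin 3,
      (colourVec (zmCoord 1 U) p.1 ⨯₃ colourVec (zmCoord 1 U) p.2) ⬝ᵥ (colourVec (zmCoord 1 U) p.1 ⨯₃ colourVec (zmCoord 1 U) p.2) := by
  rw [wilsonAction_one_site_eq_luscherPotential, luscherPotential, Fintype.sum_prod_type]
  ring

/-- `colourVec (zmCoord 1 U) i = vecPart U_i`. [folklore] -/
theorem colourVec_zmCoord_one (U : Cfg) (i : Fin 3) : colourVec (zmCoord 1 U) i = vecPart (U (edgeOf i)) := by
  rw [colourVec_zmCoord]; funext a; rw [div_one]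

/-- `ρ(U)² = ‖zmCoord 1 U‖² = Σ_i |u⃗_i|²`. [folklore] -/
theorem norm_zmCoord_sq_eq_sum_dot (U : Cfg) :
    ‖zmCoord 1 U‖ ^ 2 = ∑ i : Fin 3, colourVec (zmCoord 1 U) i ⬝ᵥ colourVec (zmCoord 1 U) i := by
  rw [norm_sq_eq_sum_csq]; rfl

/-- `D(W) = Σ_e (2 − 2w_{e,0})` summed over `Fin 3` instead of the edges. [folklore] -/
theorem sum_edge_eq_sum_fin (W : Cfg) :
    ∑ e : Edge 3 1, (2 - 2 * scalarPart (W e)) = ∑ i : Fin 3, (2 - 2 * scalarPart (W (edgeOf i))) := by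
  rw [← edgeFin.symm.sum_comp]; rfl

/-- The colour vectors after the step are `u⃗_i + α_i` with `α_i = vecPart(U_iW_i) − vecPart U_i`. [folklore] -/
theorem colourVec_zmCoord_one_mul (U W : Cfg) (i : Fin 3) :
    colourVec (zmCoord 1 (U * W)) i = colourVec (zmCoord 1 U) i + (vecPart (U (edgeOf i) * W (edgeOf i)) - vecPart (U (edgeOf i))) := by
  rw [colourVec_zmCoord_one, colourVec_zmCoord_one, Pi.mul_apply]; abel

/-- **Action deficit of a kinetic step (global, algebraic)**: for all `U, W ∈ SU(2)³`,
`S(U·W) ≥ S(U) − 4√2 ρ(U) √S(U) √D(W) − 2√2 √S(U) D(W)`, `D(W) = Σ_e (2 − Re tr W_e)`, `ρ(U) = ‖zmCoord 1 U‖`.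
(Pair inequality `pair_step_ge`, `|α_e|² ≤ 2 − Re tr W_e`, and Cauchy–Schwarz over the pairs.) [cite: Luscher1983, §2]
[cite: SimonB1983DiscreteSpectrum, §2] -/
theorem wilsonAction_mul_ge (U W : Cfg) :
    wilsonAction su2Rep U - 4 * Real.sqrt 2 * ‖zmCoord 1 U‖ * √(wilsonAction su2Rep U) * √(∑ e : Edge 3 1, (2 - 2 * scalarPart (W e)))
      - 2 * Real.sqrt 2 * √(wilsonAction su2Rep U) * ∑ e : Edge 3 1, (2 - 2 * scalarPart (W e))
      ≤ wilsonAction su2Rep (U * W) := by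
  -- abbreviations (values, not functions)
  obtain ⟨x, hx⟩ : ∃ x : Fin 3 → Fin 3 → ℝ, x = fun i => colourVec (zmCoord 1 U) i := ⟨_, rfl⟩
  obtain ⟨α, hα⟩ : ∃ α : Fin 3 → Fin 3 → ℝ, α = fun i => vecPart (U (edgeOf i) * W (edgeOf i)) - vecPart (U (edgeOf i)) :=
    ⟨_, rfl⟩
  obtain ⟨d, hd⟩ : ∃ d : Fin 3 → ℝ, d = fun i => 2 - 2 * scalarPart (W (edgeOf i)) := ⟨_, rfl⟩
  have hcvU : ∀ i, colourVec (zmCoord 1 U) i = x i := fun i => by rw [hx]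
  have hcvUW : ∀ i, colourVec (zmCoord 1 (U * W)) i = x i + α i := fun i => by
    rw [colourVec_zmCoord_one_mul, hx, hα]
  have hD : ∑ e : Edge 3 1, (2 - 2 * scalarPart (W e)) = ∑ i, d i := by rw [sum_edge_eq_sum_fin, hd]
  -- basic nonnegativity and `|α_i|² ≤ d_i`
  have hd0 : ∀ i, 0 ≤ d i := fun i => by rw [hd]; exact two_sub_two_mul_scalarPart_nonneg _
  have hαd : ∀ i, α i ⬝ᵥ α i ≤ d i := fun i => by rw [hα, hd]; exact dot_self_vecPart_mul_sub_le _ _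
  obtain ⟨S, hS⟩ : ∃ S : ℝ, S = wilsonAction su2Rep U := ⟨_, rfl⟩
  have hS0 : 0 ≤ S := by rw [hS]; exact wilsonAction_su2_nonneg U
  obtain ⟨D, hDdef⟩ : ∃ D : ℝ, D = ∑ i, d i := ⟨_, rfl⟩
  have hD0 : 0 ≤ D := by rw [hDdef]; exact Finset.sum_nonneg fun i _ => hd0 i
  rw [hD, ← hS, ← hDdef]
  -- the square norms as sums
  have hSU : S = 2 * ∑ p : Fin 3 × Fin 3, (x p.1 ⨯₃ x p.2) ⬝ᵥ (x p.1 ⨯₃ x p.2) := by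
    rw [hS, wilsonAction_eq_two_mul_sum_cross]; simp only [hcvU]
  have hSUW : wilsonAction su2Rep (U * W) = 2 * ∑ p : Fin 3 × Fin 3,
      ((x p.1 + α p.1) ⨯₃ (x p.2 + α p.2)) ⬝ᵥ ((x p.1 + α p.1) ⨯₃ (x p.2 + α p.2)) := by
    rw [wilsonAction_eq_two_mul_sum_cross]; simp only [hcvUW]
  have hρ : ‖zmCoord 1 U‖ ^ 2 = ∑ i, √(x i ⬝ᵥ x i) ^ 2 := by
    rw [norm_zmCoord_sq_eq_sum_dot]
    exact Finset.sum_congr rfl fun i _ => by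
      rw [hcvU, Real.sq_sqrt (show 0 ≤ x i ⬝ᵥ x i from Finset.sum_nonneg fun _ _ => mul_self_nonneg _)]
  have hρ0 : 0 ≤ ‖zmCoord 1 U‖ := norm_nonneg _
  have hρ' : √(∑ i, √(x i ⬝ᵥ x i) ^ 2) = ‖zmCoord 1 U‖ := by rw [← hρ, Real.sqrt_sq hρ0]
  -- `A = Σ |α_i|² ≤ D`
  have hA : ∑ i, √(α i ⬝ᵥ α i) ^ 2 ≤ D := by
    rw [hDdef]
    exact Finset.sum_le_sum fun i _ => by
      rw [Real.sq_sqrt (show 0 ≤ α i ⬝ᵥ α i from Finset.sum_nonneg fun _ _ => mul_self_nonneg _)]; exact hαd i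
  have hA0 : 0 ≤ ∑ i, √(α i ⬝ᵥ α i) ^ 2 := Finset.sum_nonneg fun _ _ => sq_nonneg _
  have hAs : √(∑ i, √(α i ⬝ᵥ α i) ^ 2) ≤ √D := Real.sqrt_le_sqrt hA
  -- `Σ |c_p|² = S/2`
  have hc : √(∑ p : Fin 3 × Fin 3, √((x p.1 ⨯₃ x p.2) ⬝ᵥ (x p.1 ⨯₃ x p.2)) ^ 2) = √(S / 2) := by
    congr 1
    rw [hSU]
    have : ∀ p : Fin 3 × Fin 3, √((x p.1 ⨯₃ x p.2) ⬝ᵥ (x p.1 ⨯₃ x p.2)) ^ 2 = (x p.1 ⨯₃ x p.2) ⬝ᵥ (x p.1 ⨯₃ x p.2) :=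
      fun p => Real.sq_sqrt (Finset.sum_nonneg fun _ _ => mul_self_nonneg _)
    simp only [this]
    ring
  -- summing the pair inequality
  have hsum : S - 4 * ∑ p : Fin 3 × Fin 3, √((x p.1 ⨯₃ x p.2) ⬝ᵥ (x p.1 ⨯₃ x p.2)) *
      (√(x p.1 ⬝ᵥ x p.1) * √(α p.2 ⬝ᵥ α p.2) + √(α p.1 ⬝ᵥ α p.1) * √(x p.2 ⬝ᵥ x p.2)
        + √(α p.1 ⬝ᵥ α p.1) * √(α p.2 ⬝ᵥ α p.2)) ≤ wilsonAction su2Rep (U * W) := by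
    rw [hSUW, hSU, Finset.mul_sum, Finset.mul_sum, Finset.mul_sum, ← Finset.sum_sub_distrib]
    exact Finset.sum_le_sum fun p _ => by linarith [pair_step_ge (x p.1) (x p.2) (α p.1) (α p.2)]
  -- the three Cauchy–Schwarz sums
  have cs1 := sum_pairs_mul_le (fun p : Fin 3 × Fin 3 => √((x p.1 ⨯₃ x p.2) ⬝ᵥ (x p.1 ⨯₃ x p.2)))
    (fun i => √(x i ⬝ᵥ x i)) (fun i => √(α i ⬝ᵥ α i))
  have cs2 := sum_pairs_mul_le (fun p : Fin 3 × Fin 3 => √((x p.1 ⨯₃ x p.2) ⬝ᵥ (x p.1 ⨯₃ x p.2)))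
    (fun i => √(α i ⬝ᵥ α i)) (fun i => √(x i ⬝ᵥ x i))
  have cs3 := sum_pairs_mul_le (fun p : Fin 3 × Fin 3 => √((x p.1 ⨯₃ x p.2) ⬝ᵥ (x p.1 ⨯₃ x p.2)))
    (fun i => √(α i ⬝ᵥ α i)) (fun i => √(α i ⬝ᵥ α i))
  -- (beta-reduced already)
  rw [hc, hρ'] at cs1 cs2
  rw [hc, Real.mul_self_sqrt hA0] at cs3
  -- `√(S/2) = √2 √S / 2`
  have hsq : √(S / 2) = Real.sqrt 2 * √S / 2 := by
    rw [show S / 2 = 2 * S / 4 by ring, Real.sqrt_div' _ (by norm_num : (0 : ℝ) ≤ 4), Real.sqrt_mul (by norm_num : (0 : ℝ) ≤ 2),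
      show (4 : ℝ) = 2 ^ 2 by norm_num, Real.sqrt_sq (by norm_num : (0 : ℝ) ≤ 2)]
  rw [hsq] at cs1 cs2 cs3
  have hsq0 : 0 ≤ Real.sqrt 2 * √S / 2 := by positivity
  -- monotonicity `A ≤ D`
  have hm1 : Real.sqrt 2 * √S / 2 * (‖zmCoord 1 U‖ * √(∑ i, √(α i ⬝ᵥ α i) ^ 2))
      ≤ Real.sqrt 2 * √S / 2 * (‖zmCoord 1 U‖ * √D) :=
    mul_le_mul_of_nonneg_left (mul_le_mul_of_nonneg_left hAs hρ0) hsq0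
  have hm2 : Real.sqrt 2 * √S / 2 * (√(∑ i, √(α i ⬝ᵥ α i) ^ 2) * ‖zmCoord 1 U‖)
      ≤ Real.sqrt 2 * √S / 2 * (√D * ‖zmCoord 1 U‖) :=
    mul_le_mul_of_nonneg_left (mul_le_mul_of_nonneg_right hAs hρ0) hsq0
  have hm3 : Real.sqrt 2 * √S / 2 * (∑ i, √(α i ⬝ᵥ α i) ^ 2) ≤ Real.sqrt 2 * √S / 2 * D :=
    mul_le_mul_of_nonneg_left hA hsq0
  -- split the combined sum into the three Cauchy–Schwarz sums
  have hsplit : ∑ p : Fin 3 × Fin 3, √((x p.1 ⨯₃ x p.2) ⬝ᵥ (x p.1 ⨯₃ x p.2)) *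
      (√(x p.1 ⬝ᵥ x p.1) * √(α p.2 ⬝ᵥ α p.2) + √(α p.1 ⬝ᵥ α p.1) * √(x p.2 ⬝ᵥ x p.2)
        + √(α p.1 ⬝ᵥ α p.1) * √(α p.2 ⬝ᵥ α p.2))
      = ∑ p : Fin 3 × Fin 3, √((x p.1 ⨯₃ x p.2) ⬝ᵥ (x p.1 ⨯₃ x p.2)) * (√(x p.1 ⬝ᵥ x p.1) * √(α p.2 ⬝ᵥ α p.2))
        + ∑ p : Fin 3 × Fin 3, √((x p.1 ⨯₃ x p.2) ⬝ᵥ (x p.1 ⨯₃ x p.2)) * (√(α p.1 ⬝ᵥ α p.1) * √(x p.2 ⬝ᵥ x p.2))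
        + ∑ p : Fin 3 × Fin 3, √((x p.1 ⨯₃ x p.2) ⬝ᵥ (x p.1 ⨯₃ x p.2)) * (√(α p.1 ⬝ᵥ α p.1) * √(α p.2 ⬝ᵥ α p.2)) := by
    rw [← Finset.sum_add_distrib, ← Finset.sum_add_distrib]
    exact Finset.sum_congr rfl fun p _ => by ring
  have htot : 4 * ∑ p : Fin 3 × Fin 3, √((x p.1 ⨯₃ x p.2) ⬝ᵥ (x p.1 ⨯₃ x p.2)) *
      (√(x p.1 ⬝ᵥ x p.1) * √(α p.2 ⬝ᵥ α p.2) + √(α p.1 ⬝ᵥ α p.1) * √(x p.2 ⬝ᵥ x p.2)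
        + √(α p.1 ⬝ᵥ α p.1) * √(α p.2 ⬝ᵥ α p.2))
      ≤ 4 * Real.sqrt 2 * ‖zmCoord 1 U‖ * √S * √D + 2 * Real.sqrt 2 * √S * D := by
    rw [hsplit]
    have h3 := add_le_add (add_le_add (cs1.trans hm1) (cs2.trans hm2)) (cs3.trans hm3)
    have e : 4 * (Real.sqrt 2 * √S / 2 * (‖zmCoord 1 U‖ * √D) + Real.sqrt 2 * √S / 2 * (√D * ‖zmCoord 1 U‖)
        + Real.sqrt 2 * √S / 2 * D) = 4 * Real.sqrt 2 * ‖zmCoord 1 U‖ * √S * √D + 2 * Real.sqrt 2 * √S * D := by ring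
    linarith [h3, e]
  linarith [hsum, htot]

/-! ### §5. The GLOBAL exponent bound of the weighted supersolution test -/

/-- **Global exponent bound** (`η = ½` allocation): for every `τ ≥ −½` and all `U, W ∈ SU(2)³`,
`(τ−½)S(U) + Σ_e Re tr(U_e (U·W)_e⁻¹) − (½+τ) S(U·W) ≤ 6 − ½S(U) − D(W)(1 − 16(½+τ)²ρ(U)² − 2√2(½+τ)√S(U))`,
`D(W) = Σ_e (2 − Re tr W_e)`, `ρ(U)² = ‖zmCoord 1 U‖²`.  Multiplied by `B` this bounds the exponent of
`e^{(τ−½)BS(U)} K̃_B(U,V) e^{−(½+τ)BS(V)}` (`K̃_B = e^{B Σ Re tr}`), the integrand of `(K_B h)(U)/h(U)` for the weight `h = e^{−τBS}`.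
[cite: SimonB1983DiscreteSpectrum, §2] [cite: Luscher1983, §2] -/
theorem valley_exponent_le (τ : ℝ) (hτ : 0 ≤ 1 / 2 + τ) (U W : Cfg) :
    (τ - 1 / 2) * wilsonAction su2Rep U + timeCoupling su2Rep U (U * W) - (1 / 2 + τ) * wilsonAction su2Rep (U * W)
      ≤ 6 - wilsonAction su2Rep U / 2
        - (∑ e : Edge 3 1, (2 - 2 * scalarPart (W e)))
          * (1 - 16 * (1 / 2 + τ) ^ 2 * ‖zmCoord 1 U‖ ^ 2 - 2 * Real.sqrt 2 * (1 / 2 + τ) * √(wilsonAction su2Rep U)) := by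
  set S := wilsonAction su2Rep U with hS
  set D := ∑ e : Edge 3 1, (2 - 2 * scalarPart (W e)) with hD
  set ρ := ‖zmCoord 1 U‖ with hρ
  have hstep : S - 4 * Real.sqrt 2 * ρ * √S * √D - 2 * Real.sqrt 2 * √S * D ≤ wilsonAction su2Rep (U * W) :=
    wilsonAction_mul_ge U W
  rw [timeCoupling_mul_eq, ← hD]
  have hS0 : 0 ≤ S := wilsonAction_su2_nonneg U
  have hD0 : 0 ≤ D := Finset.sum_nonneg fun e _ => two_sub_two_mul_scalarPart_nonneg _
  have hρ0 : 0 ≤ ρ := norm_nonneg _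
  have hsS : √S ^ 2 = S := Real.sq_sqrt hS0
  have hsD : √D ^ 2 = D := Real.sq_sqrt hD0
  have hs2 : Real.sqrt 2 ^ 2 = 2 := Real.sq_sqrt (by norm_num)
  -- AM–GM: `(½+τ)·4√2 ρ √S √D ≤ S/2 + 16(½+τ)² ρ² D`
  have hamgm : (1 / 2 + τ) * (4 * Real.sqrt 2 * ρ * √S * √D) ≤ S / 2 + 16 * (1 / 2 + τ) ^ 2 * ρ ^ 2 * D := by
    have h := two_mul_le_add_sq (√S) (4 * Real.sqrt 2 * (1 / 2 + τ) * ρ * √D)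
    have e : (4 * Real.sqrt 2 * (1 / 2 + τ) * ρ * √D) ^ 2 = 32 * (1 / 2 + τ) ^ 2 * ρ ^ 2 * D := by
      rw [show (4 * Real.sqrt 2 * (1 / 2 + τ) * ρ * √D) ^ 2 = 16 * Real.sqrt 2 ^ 2 * (1 / 2 + τ) ^ 2 * ρ ^ 2 * √D ^ 2 by ring,
        hs2, hsD]
      ring
    rw [hsS, e] at h
    linarith
  -- monotonicity: `−(½+τ)·S(UW) ≤ −(½+τ)·(lower bound)`
  have hmono := mul_le_mul_of_nonneg_left hstep hτ
  have e2 : (1 / 2 + τ) * (S - 4 * Real.sqrt 2 * ρ * √S * √D - 2 * Real.sqrt 2 * √S * D)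
      = (1 / 2 + τ) * S - (1 / 2 + τ) * (4 * Real.sqrt 2 * ρ * √S * √D) - (1 / 2 + τ) * (2 * Real.sqrt 2 * √S * D) := by ring
  have e3 : 6 - S / 2 - D * (1 - 16 * (1 / 2 + τ) ^ 2 * ρ ^ 2 - 2 * Real.sqrt 2 * (1 / 2 + τ) * √S)
      = 6 - S / 2 - D + 16 * (1 / 2 + τ) ^ 2 * ρ ^ 2 * D + (1 / 2 + τ) * (2 * Real.sqrt 2 * √S * D) := by ring
  rw [e3]
  rw [e2] at hmono
  linarith

end Summit.QuantumFields.YangMills.Theorems.FemtoTransferGap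

end
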